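import Summits.QuantumFields.YangMills.Theorems.UnitScaleGibbsActionDerivativeFlowHessian
import Summits.QuantumFields.YangMills.Theorems.UnitScaleGibbsOnEventHessianAxialGauge
import Summits.QuantumFields.YangMills.Theorems.PoincareLipschitzMeanDeviationOfShallowSecondMoment
import Literature.MathematicalPhysics.QuantumFieldTheory.Balaban1983to89.B16Ineq19NearFlatSliceNorms
import HarnessLib

/-!
# LINE 28 «GrossTransfer» — `stub_hessOnEvent` AS REGISTERED (stmt-QuantumFields-23083): the expected dressed Hessian is the curl energy up to
# small-field corrections and the large-field mass

Crux of record `RevelationMartingale.MeanDeviationL` (stmt-QuantumFields-23083; skeleton v2 `Cruxes/HistoryTailL/Lines/gross_transfer.lean`, sha16 5d16c6d70f019e13,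
ideator ym-r3-idea-2 g16), cell `ym3-torus` (YM ladder rung R3 = continuum `SU(2)` Yang–Mills on T³ — a RUNG, NOT the Clay problem); width seat `ym3-torus-px10` gen 7
(first refusal offered by px17 g7, 2026-08-29).

THE STUB (registered text, 802 chars, LEFT currency of ✓ `UnitScaleGibbsActionDerivativeSlotCalculus`: `actionDeriv₂ (fundamentalRep (Fin 2)) u (V U)`, `V U = U^{axialGauge U lo hi}`,
Frobenius norms): an ABSOLUTE constant `C` with, for every family∕coupling∕level `K`, every non-wrapping box `[lo, hi]` of side `≤ n`, every skew-Hermitian traceless test field `u`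
supported on inner off-tree box bonds and every `θ > 0`,
`∫ (∂_u∂_u A_W)(V U) dμ_K ≤ C·Σ_p ‖(du)_p‖² + C·(n+1)²(θ+θ²)·Σ_b ‖u_b‖² + C·(Σ_b ‖u_b‖²)·μ_K{¬ all box plaquettes θ-small}`.

THE PROOF (three pointwise facts, one `integral_mono`; `C = 256`):
* OFF the event (every `U`): `(∂_u∂_u A_W)(V U) ≤ 8(d−1)·Σ_b‖u_b‖²` — px17 g7 ✓ `UnitScaleGibbsActionDerivativeFlowHessian.abs_actionDeriv₂_le_opNorm` (Node00's global letter in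
  `actionDeriv₂` currency) + Node00 ✓ `sum_plaq_boundary_sq_le` + `‖X‖_op ≤ ‖X‖_HS` (lit ✓ `B16Ineq19NearFlatSliceNorms.opNorm_coe_sq_le_norm_sq_lieSU`);
* ON the event: every box bond of `V U` is within `η = (d−1)nθ` of `1` (✓ `UnitScaleGibbsOnEventHessianAxialGauge.norm_gaugeAct_axialGauge_sub_one_le`, the torus non-abelian
  Poincaré lemma of `T4AxialGaugeSmallField`), `u` vanishes off the inner box, so Node00's SUPPORT-LOCAL LEFT-CHART letter ✓ `abs_deriv_deriv_wilsonAction4_leftChart_sub_flat_le_l2_local`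
  (through px17's dictionary ✓ `actionDeriv₂_eq_deriv_deriv_leftChart`) and the flat value ✓ `deriv_deriv_wilsonAction4_expChart_one_eq_norm_sq` give
  `(∂_u∂_u A_W)(V U) ≤ N⁻¹Σ_p‖(du)_p‖² + 64(d−1)η·Σ_b‖u_b‖²`;
* hence for EVERY `U`: `H U ≤ ½Σ_p‖(du)_p‖² + 256nθ·Σ_b‖u_b‖² + 16Σ_b‖u_b‖²·𝟙_{T}(U)`, `T` a measurable hull of the large-field event; integrate (`μ_K` is a probability measure; if `H`
  were not integrable its Bochner integral is `0 ≤` the right side) — no measurability row for `V` or for the event is load-bearing.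

HONEST SCOPE.  Deterministic norm bookkeeping over LANDED letters (Node00, px17's slot dictionary, the axial-gauge Poincaré lemma) plus one integral split; proves the registered
stub `stub_hessOnEvent` of LINE 28 and NOTHING of `stub_linTest` ∕ `stub_condSD` ∕ `stub_peierls0` ∕ `stub_meanDeviationDeep`, «ShallowFluxSecondMomentL», (Q), 23083, 23133,
23134, K1∕K2, `HistoryTailL`, rung R3; R3 = continuum `SU(2)` YM on T³ — NOT d = 4, NOT infinite volume, NOT a mass gap, NOT Clay; the Yang–Mills mass gap is NOT proved.
THEOREMS ONLY (0 `def`, 0 `sorry`); `--supports stmt-QuantumFields-23083` (STUB mode).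

References: L. Gross, CMP 92 (1983) 137–162, proof of Thm 2.2 p.143 [GrossCMP1983]; T. Bałaban, CMP 122 (1989) 355–392, (1.7) p.358 [Balaban1989LargeFieldII];
T. Bałaban, CMP 99 (1985) 389–434, (3.10) p.392 [Balaban1985BackgroundPropagators]; T. Bałaban, CMP 98 (1985) 17–51, (17)∕(20) p.21 [Balaban1985Averaging].
-/

set_option autoImplicit false

open MeasureTheory
open scoped BigOperators
open Literature.MathematicalPhysics.QuantumFieldTheory.Balaban1983to89
open T4AdjointCovarianceUnitary (lieSU mem_lieSU_iff)
open Literature.MathematicalPhysics.QuantumFieldTheory.Balaban1983to89.Node00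
  (abs_deriv_deriv_wilsonAction4_leftChart_sub_flat_le_l2_local deriv_deriv_wilsonAction4_expChart_one_eq_norm_sq sum_plaq_boundary_sq_le norm_sq_lieSU_eq_re_trace)
open Literature.MathematicalPhysics.QuantumFieldTheory.Balaban1983to89.T4AxialGaugeSmallField (axialGauge boxPlaqs boxBonds castSite castSite_add_e)
open Literature.MathematicalPhysics.QuantumFieldTheory.Balaban1983to89.B7Prop1Explicit (e)
open Literature.MathematicalPhysics.QuantumLattice (fundamentalRep)
open Literature.MathematicalPhysics.QuantumFieldTheory.Balaban1983to89.B16Ineq19NearFlatSliceNorms (opNorm_coe_sq_le_norm_sq_lieSU sum_opNorm_coe_sq_le_sum_norm_sq)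
open Summit.QuantumFields.YangMills.Theorems.UnitScaleGibbsActionDerivativeSlotCalculus (actionDeriv actionDeriv₂ slotBond)
open Summit.QuantumFields.YangMills.Theorems.UnitScaleGibbsActionDerivativeFlowHessian (actionDeriv₂_eq_deriv_deriv_leftChart abs_actionDeriv₂_le_opNorm)
open Summit.QuantumFields.YangMills.Theorems.UnitScaleGibbsOnEventHessianAxialGauge (norm_gaugeAct_axialGauge_sub_one_le mem_boxPlaqs_of_bond_mem_inner e_apply_nonneg)

namespace Summit.QuantumFields.YangMills.Theorems.GrossTransferStubHessOnEvent

/-! ## §1 Letters in operator-norm currency with Hilbert–Schmidt right-hand sides -/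

section Letters

open scoped Matrix.Norms.L2Operator

variable {N : ℕ} {P : Params} {j : ℕ}

/-- The four-letter sums against the Hilbert–Schmidt 1-form mass: `Σ_p (Σ_k ‖Y_{b_k(p)}‖_op)² ≤ 8(d−1)·Σ_b ‖Y_b‖²` (Node00's incidence count + `‖·‖_op ≤ ‖·‖_HS`).
[cite: Balaban1985Averaging, (20) p.21] -/
theorem sum_slot_sq_le (Y : PBond P j → lieSU (Fin N)) :
    ∑ p : Plaq P j, (‖(Y ⟨p.src, p.μ⟩ : Matrix (Fin N) (Fin N) ℂ)‖ + ‖(Y ⟨p.src.shift p.μ, p.ν⟩ : Matrix (Fin N) (Fin N) ℂ)‖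
        + ‖(Y ⟨p.src.shift p.ν, p.μ⟩ : Matrix (Fin N) (Fin N) ℂ)‖ + ‖(Y ⟨p.src, p.ν⟩ : Matrix (Fin N) (Fin N) ℂ)‖) ^ 2
      ≤ 8 * ((P.d : ℝ) - 1) * ∑ b : PBond P j, ‖Y b‖ ^ 2 := by
  have hd : (0 : ℝ) ≤ 8 * ((P.d : ℝ) - 1) := by
    have : (1 : ℝ) ≤ P.d := by exact_mod_cast P.hd
    linarith
  exact (sum_plaq_boundary_sq_le fun b => ‖(Y b : Matrix (Fin N) (Fin N) ℂ)‖).trans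
    (mul_le_mul_of_nonneg_left (Finset.sum_le_sum fun b _ => opNorm_coe_sq_le_norm_sq_lieSU (Y b)) hd)

variable [NeZero N]

/-- ★ **OFF THE EVENT** (every background): `(∂_Y∂_Y A_W)(U) ≤ 8(d−1)·Σ_b ‖Y_b‖²` — px17's `abs_actionDeriv₂_le_opNorm` (Node00's global letter) against the Hilbert–Schmidt mass.
[cite: Balaban1985BackgroundPropagators, (3.10) p.392] [cite: GrossCMP1983, Thm 2.2 (proof) p.143] -/
theorem actionDeriv₂_le_sum_norm_sq (U : GaugeField P j (Matrix.specialUnitaryGroup (Fin N) ℂ)) (Y : PBond P j → lieSU (Fin N)) :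
    actionDeriv₂ (fundamentalRep (Fin N)) (fun b => (Y b : Matrix (Fin N) (Fin N) ℂ)) U ≤ 8 * ((P.d : ℝ) - 1) * ∑ b : PBond P j, ‖Y b‖ ^ 2 :=
  (le_abs_self _).trans ((abs_actionDeriv₂_le_opNorm U Y).trans (sum_slot_sq_le Y))

/-- ★★ **ON THE EVENT, BONDWISE FORM**: if the bond variables of `V` in `boxBonds lo hi` are within `η ≥ 0` of `1` and `Y` vanishes off the inner box `boxBonds (lo+1) (hi−1)`, then
`(∂_Y∂_Y A_W)(V) ≤ N⁻¹Σ_p ‖(dY)_p‖² + 64(d−1)η·Σ_b ‖Y_b‖²` (Node00's support-local left-chart letter through px17's dictionary, the flat value as a Hilbert–Schmidt square).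
[cite: Balaban1989LargeFieldII, (1.7) p.358] [cite: Balaban1985BackgroundPropagators, (3.10) p.392] -/
theorem actionDeriv₂_le_flat_add_of_bondSmallOn_box (V : GaugeField P j (Matrix.specialUnitaryGroup (Fin N) ℂ)) {lo hi : Fin P.d → ℤ} {η : ℝ} (hη : 0 ≤ η)
    (hV : ∀ b : PBond P j, b ∈ boxBonds lo hi → ‖((V b : Matrix.specialUnitaryGroup (Fin N) ℂ) : Matrix (Fin N) (Fin N) ℂ) - 1‖ ≤ η)
    (Y : PBond P j → lieSU (Fin N)) (hYsupp : ∀ b : PBond P j, b ∉ boxBonds (lo + 1) (hi - 1) → Y b = 0) :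
    actionDeriv₂ (fundamentalRep (Fin N)) (fun b => (Y b : Matrix (Fin N) (Fin N) ℂ)) V
      ≤ (∑ p : Plaq P j, ‖Y ⟨p.src, p.μ⟩ + Y ⟨p.src.shift p.μ, p.ν⟩ - Y ⟨p.src.shift p.ν, p.μ⟩ - Y ⟨p.src, p.ν⟩‖ ^ 2) / (Fintype.card (Fin N) : ℝ)
        + 64 * ((P.d : ℝ) - 1) * η * ∑ b : PBond P j, ‖Y b‖ ^ 2 := by
  -- the four bonds of a box plaquette are box bonds (the statement of ✓ `ShellMeasureWilsonGaugeInvariant.bonds_mem_boxBonds`, re-derived locally)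
  have hbonds : ∀ p : Plaq P j, p ∈ boxPlaqs lo hi → (⟨p.src, p.μ⟩ : PBond P j) ∈ boxBonds lo hi ∧ (⟨p.src.shift p.μ, p.ν⟩ : PBond P j) ∈ boxBonds lo hi ∧
      (⟨p.src.shift p.ν, p.μ⟩ : PBond P j) ∈ boxBonds lo hi ∧ (⟨p.src, p.ν⟩ : PBond P j) ∈ boxBonds lo hi := by
    rintro p ⟨z, hlo, hhi, hsrc⟩
    have hμ0 := e_apply_nonneg (P := P) p.μ
    have hν0 := e_apply_nonneg (P := P) p.ν
    rw [Pi.le_def] at hlo hhi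
    refine ⟨⟨z, Pi.le_def.2 hlo, Pi.le_def.2 fun κ => ?_, hsrc⟩, ⟨z + e p.μ, Pi.le_def.2 fun κ => ?_, Pi.le_def.2 fun κ => ?_, ?_⟩,
      ⟨z + e p.ν, Pi.le_def.2 fun κ => ?_, Pi.le_def.2 fun κ => ?_, ?_⟩, ⟨z, Pi.le_def.2 hlo, Pi.le_def.2 fun κ => ?_, hsrc⟩⟩
    · have := hhi κ; simp only [Pi.add_apply] at this ⊢; linarith [hν0 κ]
    · have := hlo κ; simp only [Pi.add_apply]; linarith [hμ0 κ]
    · have := hhi κ; simp only [Pi.add_apply] at this ⊢; linarith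
    · rw [hsrc, castSite_add_e]
    · have := hlo κ; simp only [Pi.add_apply]; linarith [hν0 κ]
    · have := hhi κ; simp only [Pi.add_apply] at this ⊢; linarith
    · rw [hsrc, castSite_add_e]
    · have := hhi κ; simp only [Pi.add_apply] at this ⊢; linarith [hμ0 κ]
  have hloc := abs_deriv_deriv_wilsonAction4_leftChart_sub_flat_le_l2_local V Y (boxBonds (lo + 1) (hi - 1)) hYsupp hη
    (fun p hp => by
      obtain ⟨h1, h2, h3, h4⟩ := hbonds p (mem_boxPlaqs_of_bond_mem_inner hp)
      exact ⟨hV _ h1, hV _ h2, hV _ h3, hV _ h4⟩)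
  rw [deriv_deriv_wilsonAction4_expChart_one_eq_norm_sq] at hloc
  rw [actionDeriv₂_eq_deriv_deriv_leftChart]
  have hsum := sum_opNorm_coe_sq_le_sum_norm_sq Y
  have hd : (0 : ℝ) ≤ 64 * ((P.d : ℝ) - 1) * η := by
    have : (1 : ℝ) ≤ P.d := by exact_mod_cast P.hd
    have : (0 : ℝ) ≤ (P.d : ℝ) - 1 := by linarith
    positivity
  have := mul_le_mul_of_nonneg_left hsum hd
  linarith [(abs_le.1 hloc).2]

/-- ★★ **ON THE EVENT, AXIAL INSTANCE**: on the axial-gauge representative `V = U^{axialGauge U lo hi}` of a box `[lo, hi]` (side `≤ n < sitesPerDir j`) whose plaquettes are `θ`-small,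
`(∂_Y∂_Y A_W)(V) ≤ N⁻¹Σ_p ‖(dY)_p‖² + 64(d−1)·((d−1)nθ)·Σ_b ‖Y_b‖²` for `Y` vanishing off the inner box. [cite: Balaban1989LargeFieldII, (1.7) p.358] [cite: GrossCMP1983, Thm 2.2 (proof) p.143] -/
theorem actionDeriv₂_axialGaugeRep_le_flat_add (U : GaugeField P j (Matrix.specialUnitaryGroup (Fin N) ℂ)) {lo hi : Fin P.d → ℤ} {θ : ℝ} {n : ℕ}
    (hU : PlaqSmallOn (boxPlaqs lo hi) θ U) (hθ : 0 ≤ θ) (hn : ∀ κ, hi κ ≤ lo κ + n) (hnN : n < P.sitesPerDir j)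
    (Y : PBond P j → lieSU (Fin N)) (hYsupp : ∀ b : PBond P j, b ∉ boxBonds (lo + 1) (hi - 1) → Y b = 0) :
    actionDeriv₂ (fundamentalRep (Fin N)) (fun b => (Y b : Matrix (Fin N) (Fin N) ℂ)) (GaugeField.gaugeAct (axialGauge U lo hi) U)
      ≤ (∑ p : Plaq P j, ‖Y ⟨p.src, p.μ⟩ + Y ⟨p.src.shift p.μ, p.ν⟩ - Y ⟨p.src.shift p.ν, p.μ⟩ - Y ⟨p.src, p.ν⟩‖ ^ 2) / (Fintype.card (Fin N) : ℝ)
        + 64 * ((P.d : ℝ) - 1) * ((((P.d - 1 : ℕ) : ℝ)) * n * θ) * ∑ b : PBond P j, ‖Y b‖ ^ 2 :=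
  actionDeriv₂_le_flat_add_of_bondSmallOn_box _ (by positivity) (fun _ hb => norm_gaugeAct_axialGauge_sub_one_le U hU hθ hn hnN hb) Y hYsupp

end Letters

/-! ## §2 The two-level integral split (abstract; no measurability of the event needed) -/

section TwoLevel

/-- **TWO-LEVEL INTEGRAL BOUND**: on a probability space, if `H ≤ a` off a set `B` (`a ≥ 0`) and `H ≤ c` everywhere (`c ≥ 0`), then `∫ H ≤ a + c·μ(B)` — through a measurable hull of
`B` and the dominating simple function `a + c·𝟙`; if `H` is not integrable its Bochner integral is `0 ≤ a + c·μ(B)`. [cite: GrossCMP1983, Thm 2.2 (proof) p.143] -/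
theorem integral_le_of_twoLevel {α : Type*} [MeasurableSpace α] {μ : Measure α} [IsProbabilityMeasure μ] {H : α → ℝ} {B : Set α} {a c : ℝ}
    (ha : 0 ≤ a) (hc : 0 ≤ c) (hon : ∀ x, x ∉ B → H x ≤ a) (hoff : ∀ x, H x ≤ c) :
    ∫ x, H x ∂μ ≤ a + c * μ.real B := by
  set T := toMeasurable μ B with hT
  have hTm : MeasurableSet T := measurableSet_toMeasurable μ B
  have hBT : B ⊆ T := subset_toMeasurable μ B
  have hTB : μ.real T = μ.real B := by
    show (μ T).toReal = (μ B).toReal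
    rw [hT, measure_toMeasurable]
  have hle : ∀ x, H x ≤ a + T.indicator (fun _ => c) x := fun x => by
    by_cases hx : x ∈ B
    · rw [Set.indicator_of_mem (hBT hx)]
      linarith [hoff x]
    · have h0 : 0 ≤ T.indicator (fun _ => c) x := Set.indicator_nonneg (fun _ _ => hc) x
      linarith [hon x hx]
  have hg : Integrable (fun x => a + T.indicator (fun _ => c) x) μ := (integrable_const a).add ((integrable_const c).indicator hTm)
  have hval : ∫ x, (a + T.indicator (fun _ => c) x) ∂μ = a + c * μ.real B := by
    rw [integral_add (integrable_const a) ((integrable_const c).indicator hTm), integral_const, integral_indicator_const _ hTm,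
      smul_eq_mul, smul_eq_mul, hTB, probReal_univ]
    ring
  by_cases hH : Integrable H μ
  · exact (integral_mono hH hg hle).trans_eq hval
  · rw [integral_undef hH]
    exact add_nonneg ha (mul_nonneg hc measureReal_nonneg)

end TwoLevel

/-! ## §3 The registered stub -/

section Stub

open scoped Matrix.Norms.Frobenius
open Literature.MathematicalPhysics.QuantumFieldTheory.Balaban1983to89.T3ContinuumYM3Torus
open Literature.MathematicalPhysics.QuantumFieldTheory.Balaban1983to89.T3UnitScaleTilt
open Literature.MathematicalPhysics.QuantumFieldTheory.Balaban1983to89.T3UnitLawDensityEML (ℰp)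
open Literature.MathematicalPhysics.QuantumFieldTheory.Balaban1983to89.B8Lemma1NonAbelian (lowPart)

/-- ★★★ **`stub_hessOnEvent` OF LINE 28 «GrossTransfer», AS REGISTERED on stmt-QuantumFields-23083** (skeleton v2 5d16c6d70f019e13, token-identical text): THE EXPECTED HESSIAN IN
THE DRESSED GAUGE IS THE CURL ENERGY up to small-field corrections and the large-field mass, with the absolute constant `C = 256` (`d = 3`, `N = 2`): for every box∕test field as in
`stub_condSD` and EVERY `θ > 0`,
`∫ (∂_u∂_u A_W)(V U) dμ_K ≤ C·Σ_p ‖(du)_p‖² + C·(n+1)²(θ + θ²)·Σ_b ‖u_b‖² + C·(Σ_b ‖u_b‖²)·μ_K{¬ all box plaquettes θ-small}`.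
[cite: GrossCMP1983, Thm 2.2 (proof) p.143] [cite: Balaban1989LargeFieldII, (1.7) p.358] -/
theorem stub_hessOnEvent :
    ∃ C : ℝ, 0 ≤ C ∧ ∀ (F : T3Family) (γ : ℝ), 0 ≤ γ → ∀ (K : ℕ) (lo hi : Fin (F.P K).d → ℤ) (n : ℕ)
          (u : PBond (F.P K) 0 → Matrix (Fin 2) (Fin 2) ℂ),
          (∀ κ, lo κ ≤ hi κ ∧ hi κ ≤ lo κ + n) → n < (F.P K).sitesPerDir 0 →
          (∀ b, star (u b) = -(u b) ∧ (u b).trace = 0) →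
          (∀ b, u b ≠ 0 → ∃ x : Fin (F.P K).d → ℤ,
              lo + 1 ≤ x ∧ x + e b.dir + 1 ≤ hi ∧ b.src = castSite x ∧ lowPart b.dir (x - lo) ≠ 0) →
          ∀ θ : ℝ, 0 < θ →
            ∫ U, actionDeriv₂ (fundamentalRep (Fin 2)) u (GaugeField.gaugeAct (axialGauge U lo hi) U) ∂(gibbsK F ℰp γ K)
              ≤ C * ∑ p : Plaq (F.P K) 0, ‖u (slotBond p 0) + u (slotBond p 1) - u (slotBond p 2) - u (slotBond p 3)‖ ^ 2
                + C * ((n : ℝ) + 1) ^ 2 * (θ + θ ^ 2) * ∑ b : PBond (F.P K) 0, ‖u b‖ ^ 2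
                + C * (∑ b : PBond (F.P K) 0, ‖u b‖ ^ 2)
                    * (gibbsK F ℰp γ K).real {U | ¬ PlaqSmallOn (boxPlaqs lo hi) θ U} := by
  refine ⟨256, by norm_num, ?_⟩
  intro F γ hγ K lo hi n u hbox hnN hu hsupp θ hθ
  haveI := isProbabilityMeasure_gibbsK F ℰp hγ K
  -- the test field as an `𝔰𝔲(2)`-valued 1-form
  let Y : PBond (F.P K) 0 → lieSU (Fin 2) := fun b => ⟨u b, mem_lieSU_iff.2 (hu b)⟩
  have hYsupp : ∀ b : PBond (F.P K) 0, b ∉ boxBonds (lo + 1) (hi - 1) → Y b = 0 := by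
    intro b hb
    by_contra hne
    have hne' : u b ≠ 0 := fun h => hne (Subtype.ext h)
    obtain ⟨x, hlo, hhi, hsrc, -⟩ := hsupp b hne'
    refine hb ⟨x, hlo, Pi.le_def.2 fun κ => ?_, hsrc⟩
    have := (Pi.le_def.1 hhi) κ
    simp only [Pi.add_apply, Pi.sub_apply, Pi.one_apply] at this ⊢
    linarith
  -- abbreviations
  set μ := gibbsK F ℰp γ K with hμ
  set S : ℝ := ∑ b : PBond (F.P K) 0, ‖u b‖ ^ 2 with hS
  set Φ : ℝ := ∑ p : Plaq (F.P K) 0, ‖u (slotBond p 0) + u (slotBond p 1) - u (slotBond p 2) - u (slotBond p 3)‖ ^ 2 with hΦ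
  set B : Set (GaugeField (F.P K) 0 (Matrix.specialUnitaryGroup (Fin 2) ℂ)) := {U | ¬ PlaqSmallOn (boxPlaqs lo hi) θ U} with hB
  set H : GaugeField (F.P K) 0 (Matrix.specialUnitaryGroup (Fin 2) ℂ) → ℝ :=
    fun U => actionDeriv₂ (fundamentalRep (Fin 2)) u (GaugeField.gaugeAct (axialGauge U lo hi) U) with hH
  have hS0 : 0 ≤ S := Finset.sum_nonneg fun b _ => sq_nonneg _
  have hΦ0 : 0 ≤ Φ := Finset.sum_nonneg fun p _ => sq_nonneg _
  -- dictionary between the registered (Frobenius, `slotBond`) letters and the `𝔰𝔲(2)` letters of §1 (all definitional)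
  have hSY : ∑ b : PBond (F.P K) 0, ‖Y b‖ ^ 2 = S := rfl
  have hΦY : (∑ p : Plaq (F.P K) 0, ‖Y ⟨p.src, p.μ⟩ + Y ⟨p.src.shift p.μ, p.ν⟩ - Y ⟨p.src.shift p.ν, p.μ⟩ - Y ⟨p.src, p.ν⟩‖ ^ 2) = Φ := by
    refine Finset.sum_congr rfl fun p _ => ?_
    have h0 : slotBond p 0 = ⟨p.src, p.μ⟩ := rfl
    have h1 : slotBond p 1 = ⟨p.src.shift p.μ, p.ν⟩ := rfl
    have h2 : slotBond p 2 = ⟨p.src.shift p.ν, p.μ⟩ := rfl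
    have h3 : slotBond p 3 = ⟨p.src, p.ν⟩ := rfl
    rw [h0, h1, h2, h3]
    rfl
  have hd : ((F.P K).d : ℝ) - 1 = 2 := by rw [T3Family.P_d]; norm_num
  have hd' : ((((F.P K).d - 1 : ℕ) : ℝ)) = 2 := by rw [T3Family.P_d]; norm_num
  have hcard : (Fintype.card (Fin 2) : ℝ) = 2 := by simp
  -- the two pointwise bounds
  have hoff : ∀ U, H U ≤ 16 * S := fun U => by
    have h := actionDeriv₂_le_sum_norm_sq (GaugeField.gaugeAct (axialGauge U lo hi) U) Y
    rw [hSY, hd] at h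
    have : H U = actionDeriv₂ (fundamentalRep (Fin 2)) (fun b => (Y b : Matrix (Fin 2) (Fin 2) ℂ)) (GaugeField.gaugeAct (axialGauge U lo hi) U) := rfl
    linarith
  have hon : ∀ U, PlaqSmallOn (boxPlaqs lo hi) θ U → H U ≤ Φ / 2 + 256 * n * θ * S := fun U hUG => by
    have h := actionDeriv₂_axialGaugeRep_le_flat_add U hUG hθ.le (fun κ => (hbox κ).2) hnN Y hYsupp
    rw [hSY, hΦY, hd, hd', hcard] at h
    have : H U = actionDeriv₂ (fundamentalRep (Fin 2)) (fun b => (Y b : Matrix (Fin 2) (Fin 2) ℂ)) (GaugeField.gaugeAct (axialGauge U lo hi) U) := rfl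
    linarith
  -- integrate (§2) and compare with the registered right-hand side
  have hnθS : 0 ≤ 256 * (n : ℝ) * θ * S := mul_nonneg (mul_nonneg (mul_nonneg (by norm_num) (Nat.cast_nonneg n)) hθ.le) hS0
  have ha : 0 ≤ Φ / 2 + 256 * (n : ℝ) * θ * S := by linarith
  have hint := integral_le_of_twoLevel (μ := μ) (H := H) (B := B) ha (mul_nonneg (by norm_num : (0 : ℝ) ≤ 16) hS0)
    (fun U hU => hon U (not_not.mp hU)) hoff
  have hB0 : 0 ≤ μ.real B := measureReal_nonneg
  have hSB : 0 ≤ S * μ.real B := mul_nonneg hS0 hB0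
  have hn1 : (n : ℝ) ≤ ((n : ℝ) + 1) ^ 2 :=
    (show (n : ℝ) ≤ (n : ℝ) + 1 by linarith).trans (le_self_pow₀ (by linarith [Nat.cast_nonneg (α := ℝ) n]) two_ne_zero)
  have hθ1 : θ ≤ θ + θ ^ 2 := le_add_of_nonneg_right (sq_nonneg θ)
  have hnt : (n : ℝ) * θ ≤ ((n : ℝ) + 1) ^ 2 * (θ + θ ^ 2) := mul_le_mul hn1 hθ1 hθ.le (by positivity)
  have h2 : (n : ℝ) * θ * S ≤ ((n : ℝ) + 1) ^ 2 * (θ + θ ^ 2) * S := mul_le_mul_of_nonneg_right hnt hS0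
  linarith

end Stub

end Summit.QuantumFields.YangMills.Theorems.GrossTransferStubHessOnEvent
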